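import Summits.Ventures.LatticeQCDFlow.Scaling.TaggedResidualIncome
import Summits.Ventures.LatticeQCDFlow.Scaling.TaggedStartContentAboveGlobal

/-!
HONEST FRAMING: exact (Metropolis-corrected) sampling algorithms for lattice gauge theory; figures
of merit are autocorrelation/cost numbers at stated couplings and volumes; no continuum-physics
claim.

# TaggedLoneBetweenBudget — TWO TOOLS FOR THE LONE HUB STRICTLY BETWEEN THE EXTRA PARTICLES: THE DISCOUNTED BUDGET OF THE SIGNED SUM (RESIDUAL `g`-FORM + HUB-ABOVE BOUND) AND
# THE RESIDUAL PAIR'S RESOLVENT INCOME AS A STANDALONE INEQUALITY (lean-2 GEN-42, ours)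

Venture-side (OURS).  Cell `lqcd-flow` (pub-lqcd), unit `pub-lqcd-lean-2-g42`, 2026-08-30.  Chapter AB (route (β), the cost side continued), file 15b — lemmas of file 16, split off for
the 400-line rule and the heartbeat budget.

* §1 `loneBetween_budget` (real sequences): from `ζ_n − x_n ≤ cⁿ(g_n(1) − g_n(α))` (the residual `g`-form with `α_Z = 1`), `y_{n+1} − ζ_{n+1} ≤ 𝟙{n even}c^{n+1}/2` and `y_1 ≤ ζ_1`:
  `(y−x)⁺_{n+1} ≤ 𝟙{n odd}(α/(1+α))c^{n+1} + 𝟙{n even, n≠0}((2α−1)⁺/2)c^{n+1}` and `Σ_{n<J}(1−σ)σⁿ(y_{n+1}−x_{n+1})⁺ ≤ (1−σ)[(α/(1+α))c·σc/(1−(σc)²) + ((2α−1)⁺/2)c·(σc)²/(1−(σc)²)]`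
  (GEN-41 file 3 `budget_weighted_le`, file 9 `budget_evenPos_le`).
* §2 `tagged_residual_income`: for the tagged chain `P_X` from a hub `z` alone with every other present content strictly below it and `W_z < W_a`:
  `(1−σ)[α(K−2+3θ_a)/K + σ(α/K)(1−α)(1−θ_a)/(1+α)]/((1−σ/K)(1+σα/K)) ≤ s1 = (K+M)x̃(★) − cost(x̃)`, `α = W_z/W_a` (file 7b's income argument, verbatim, as a statement).

Literature grade (cell rule): OWN; nothing cited; no new bib keys.
-/

open Finset

namespace Summit.Ventures.LatticeQCDFlow.Scaling

/-! ### §1 The discounted budget of the signed sum -/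
section LoneBudget

/-- **The budget of the lone hub strictly between** (see the module docstring). [ours] -/
theorem loneBetween_budget {xz yz ζz : ℕ → ℝ} {α c σ : ℝ} (hα0 : 0 ≤ α) (hα1 : α ≤ 1) (hc0 : 0 ≤ c) (hσ0 : 0 ≤ σ) (hσ1 : σ ≤ 1) (hσc : σ * c < 1)
    (hg : ∀ n, ζz n - xz n ≤ c ^ n * ((-(1:ℝ) - (-(1:ℝ)) ^ (n + 1)) / (1 + 1) - (-α - (-α) ^ (n + 1)) / (1 + α)))
    (hB : ∀ n, yz (n + 1) - ζz (n + 1) ≤ if Even n then c ^ (n + 1) / 2 else 0) (hO : yz 1 ≤ ζz 1) (J : ℕ) :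
    ∑ n ∈ range J, (1 - σ) * σ ^ n * max 0 (yz (n + 1) - xz (n + 1))
      ≤ (1 - σ) * ((α / (1 + α) * c) * (σ * c / (1 - (σ * c) ^ 2)) + (max 0 (2 * α - 1) / 2 * c) * ((σ * c) ^ 2 / (1 - (σ * c) ^ 2))) := by
  -- the per-step bound
  have hterm : ∀ n, max 0 (yz (n + 1) - xz (n + 1))
      ≤ (if Odd n then (α / (1 + α) * c) * c ^ n else 0) + (if Even n ∧ n ≠ 0 then (max 0 (2 * α - 1) / 2 * c) * c ^ n else 0) := by
    intro n
    have hsplit : yz (n + 1) - xz (n + 1) = (yz (n + 1) - ζz (n + 1)) + (ζz (n + 1) - xz (n + 1)) := by ring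
    have h1 := hg (n + 1)
    have h2 := hB n
    have hpow : c ^ (n + 1) = c * c ^ n := by rw [pow_succ]; ring
    rw [hpow] at h1 h2
    have hcn : 0 ≤ c * c ^ n := mul_nonneg hc0 (pow_nonneg hc0 n)
    rcases Nat.even_or_odd n with hev | hod
    · -- `n` even: attempt `n+1` odd; the hub-above half may have a deficit, the residual half is strongly negative
      rw [if_neg (Nat.not_odd_iff_even.mpr hev), zero_add]
      have hodd1 : Odd (n + 1) := hev.add_one
      have hev2 : Even (n + 1 + 1) := hodd1.add_one
      -- `g_{n+1}(1) = −1`, `g_{n+1}(α) ≥ −α`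
      have hg1 : (-(1:ℝ) - (-(1:ℝ)) ^ (n + 1 + 1)) / (1 + 1) = -1 := by rw [Even.neg_pow hev2, one_pow]; norm_num
      have hαp : α ^ (n + 1 + 1) ≤ α ^ 2 := pow_le_pow_of_le_one hα0 hα1 (by omega)
      have hgα : -((-α - (-α) ^ (n + 1 + 1)) / (1 + α)) ≤ α := by
        rw [Even.neg_pow hev2]
        have e : -((-α - α ^ (n + 1 + 1)) / (1 + α)) = (α + α ^ (n + 1 + 1)) / (1 + α) := by ring
        rw [e, div_le_iff₀ (by linarith)]
        nlinarith [hαp]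
      rw [hg1] at h1
      rw [if_pos hev] at h2
      by_cases hn0 : n = 0
      · subst hn0
        rw [if_neg (by simp)]
        refine max_le le_rfl ?_
        have h3 : yz 1 - ζz 1 ≤ 0 := by linarith [hO]
        have h4 : ζz 1 - xz 1 ≤ 0 := by
          refine h1.trans (mul_nonpos_of_nonneg_of_nonpos hcn ?_)
          linarith [hgα]
        linarith
      · rw [if_pos (show Even n ∧ n ≠ 0 from ⟨hev, hn0⟩)]
        refine max_le (mul_nonneg (mul_nonneg (by positivity) hc0) (pow_nonneg hc0 n)) ?_
        have h4 : ζz (n + 1) - xz (n + 1) ≤ c * c ^ n * (α - 1) :=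
          h1.trans (mul_le_mul_of_nonneg_left (by linarith [hgα]) hcn)
        have h5 : c * c ^ n / 2 + c * c ^ n * (α - 1) ≤ max 0 (2 * α - 1) / 2 * c * c ^ n := by
          have hm : 2 * α - 1 ≤ max 0 (2 * α - 1) := le_max_right _ _
          have := mul_le_mul_of_nonneg_left hm hcn
          linarith
        linarith [h2, h4, h5]
    · -- `n` odd: attempt `n+1` even; the hub-above half has no deficit, the residual half at most `c^{n+1}α/(1+α)`
      rw [if_pos hod, if_neg (fun h => (Nat.not_even_iff_odd.mpr hod) h.1), add_zero]
      rw [if_neg (Nat.not_even_iff_odd.mpr hod)] at h2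
      have hev1 : Even (n + 1) := hod.add_one
      have hodd2 : Odd (n + 1 + 1) := hev1.add_one
      have hg1 : (-(1:ℝ) - (-(1:ℝ)) ^ (n + 1 + 1)) / (1 + 1) = 0 := by rw [Odd.neg_pow hodd2, one_pow]; norm_num
      have hgα : -((-α - (-α) ^ (n + 1 + 1)) / (1 + α)) ≤ α / (1 + α) := by
        rw [Odd.neg_pow hodd2]
        have e : -((-α - -α ^ (n + 1 + 1)) / (1 + α)) = (α - α ^ (n + 1 + 1)) / (1 + α) := by ring
        rw [e]
        exact div_le_div_of_nonneg_right (by linarith [pow_nonneg hα0 (n + 1 + 1)]) (by linarith)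
      rw [hg1] at h1
      refine max_le (mul_nonneg (by positivity) (pow_nonneg hc0 n)) ?_
      have h4 : ζz (n + 1) - xz (n + 1) ≤ c * c ^ n * (α / (1 + α)) :=
        h1.trans (mul_le_mul_of_nonneg_left (by linarith [hgα]) hcn)
      linarith [h2, h4]
  -- the discounted sum
  have hσc0 : 0 ≤ σ * c := mul_nonneg hσ0 hc0
  have hA1 : 0 ≤ α / (1 + α) * c := by positivity
  have hA2 : 0 ≤ max 0 (2 * α - 1) / 2 * c := by positivity
  have hodd := budget_weighted_le hσ0 hc0 hσc hA1 J
  have heven : ∑ n ∈ range J, σ ^ n * (if Even n ∧ n ≠ 0 then (max 0 (2 * α - 1) / 2 * c) * c ^ n else 0)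
      ≤ (max 0 (2 * α - 1) / 2 * c) * ((σ * c) ^ 2 / (1 - (σ * c) ^ 2)) := by
    have e : ∑ n ∈ range J, σ ^ n * (if Even n ∧ n ≠ 0 then (max 0 (2 * α - 1) / 2 * c) * c ^ n else 0)
        = (max 0 (2 * α - 1) / 2 * c) * ∑ n ∈ range J, (if Even n ∧ n ≠ 0 then (σ * c) ^ n else 0) := by
      rw [mul_sum]
      refine sum_congr rfl fun n _ => ?_
      split_ifs
      · rw [mul_pow]; ring
      · ring
    rw [e]
    exact mul_le_mul_of_nonneg_left (budget_evenPos_le hσc0 hσc J) hA2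
  calc ∑ n ∈ range J, (1 - σ) * σ ^ n * max 0 (yz (n + 1) - xz (n + 1))
      ≤ ∑ n ∈ range J, (1 - σ) * (σ ^ n * ((if Odd n then (α / (1 + α) * c) * c ^ n else 0)
          + (if Even n ∧ n ≠ 0 then (max 0 (2 * α - 1) / 2 * c) * c ^ n else 0))) := by
        refine sum_le_sum fun n _ => ?_
        rw [mul_assoc]
        exact mul_le_mul_of_nonneg_left (mul_le_mul_of_nonneg_left (hterm n) (pow_nonneg hσ0 n)) (by linarith)
    _ = (1 - σ) * (∑ n ∈ range J, σ ^ n * (if Odd n then (α / (1 + α) * c) * c ^ n else 0)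
          + ∑ n ∈ range J, σ ^ n * (if Even n ∧ n ≠ 0 then (max 0 (2 * α - 1) / 2 * c) * c ^ n else 0)) := by
        rw [← sum_add_distrib, mul_sum]; exact sum_congr rfl fun n _ => by ring
    _ ≤ _ := mul_le_mul_of_nonneg_left (add_le_add hodd heven) (by linarith)

end LoneBudget

/-! ### §2 The residual pair's resolvent income as a statement -/
section ResidualIncome
variable {S : Type*} [Fintype S] [DecidableEq S]
variable {W θ : S → ℝ} {acc : S → S → ℝ} {p : ℝ} {K : ℕ} {NC : S → ℕ} {a : S} {PX : Option S → Option S → ℝ}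

/-- **The residual pair's income:** `(1−σ)[α(K−2+3θ_a)/K + σ(α/K)(1−α)(1−θ_a)/(1+α)]/((1−σ/K)(1+σα/K)) ≤ (K+M)x̃(★) − cost(x̃)`, `α = W_z/W_a` (file 7b's argument). [ours] -/
theorem tagged_residual_income (hW : ∀ v, 0 < W v) (hp0 : 0 ≤ p) (hp : ∀ v, p * W v ≤ 1) (hθ : ∀ v, θ v = 1 / (1 + p * W v))
    (hacc : ∀ h v, acc h v = min 1 (W h / W v)) (hK : 2 ≤ K) (hNC : ∑ v, NC v = K)
    (hPXoff : ∀ h v, h ≠ v → PX (some h) (some v) = if NC h = 0 then 0 else (NC v : ℝ) / K * acc h v)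
    (hPXin : ∀ h, PX (some h) none = if NC h = 0 then 0 else acc h a / K)
    (hPXdiag : ∀ h, PX (some h) (some h) = 1 - (∑ v ∈ univ.erase h, PX (some h) (some v) + PX (some h) none))
    (hPXout : ∀ v, PX none (some v) = (NC v : ℝ) / K * acc a v) (hPXstay : PX none none = 1 - ∑ v, PX none (some v))
    {z : S} (hz1 : NC z = 1) (hza : W z < W a) (hbelow : ∀ w, w ≠ z → NC w ≠ 0 → W w < W z)
    {M : ℝ} (hM : M = ∑ v, θ v * (NC v : ℝ) + θ a)
    {σ : ℝ} (hσ0 : 0 ≤ σ) (hσ1 : σ < 1) {ut : Option S → ℝ} (hut : ∀ t, ut t = (1 - σ) * PX (some z) t + σ * ∑ t', ut t' * PX t' t) :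
    (1 - σ) * (W z / W a * ((K : ℝ) - 2 + 3 * θ a) / K + σ * (W z / W a / K) * ((1 - W z / W a) * (1 - θ a) / (1 + W z / W a)))
        / ((1 - σ / K) * (1 + σ * (W z / W a) / K))
      ≤ (K + M) * ut none - (∑ v, ut (some v) * (1 - θ v) + ut none * (1 - θ a)) := by
  have hz : NC z ≠ 0 := by rw [hz1]; exact one_ne_zero
  have hK1 : 1 ≤ K := by omega
  have hK0 : (0 : ℝ) < K := by exact_mod_cast (show 0 < K by omega)
  have hK2r : (2 : ℝ) ≤ K := by exact_mod_cast hK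
  have hθm := theta_mem hW hp0 hp hθ
  -- the certificate slack (GEN-41 file 4)
  obtain ⟨r, hr⟩ : ∃ r : Option S → ℝ, ∀ t, r t = Option.elim t ((K + M) - (1 - θ a)) (fun v => -(1 - θ v)) := ⟨_, fun _ => rfl⟩
  obtain ⟨Λ, hΛ⟩ : ∃ Λ : Option S → ℝ, ∀ t, Λ t = Option.elim t (-(1 - θ a)) (fun _ => 0) := ⟨_, fun _ => rfl⟩
  obtain ⟨sl, hsl⟩ : ∃ sl : Option S → ℝ, ∀ t, sl t = ∑ t', PX t t' * (r t' + Λ t') - Λ t := ⟨_, fun _ => rfl⟩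
  have hrn : r none = (K + M) - (1 - θ a) := by rw [hr]; rfl
  have hrs : ∀ v, r (some v) = -(1 - θ v) := fun v => by rw [hr]; rfl
  have hΛn : Λ none = -(1 - θ a) := by rw [hΛ]; rfl
  have hΛs : ∀ v, Λ (some v) = 0 := fun v => by rw [hΛ]; rfl
  have heq := ledger_tail_eq hsl hut
  have hP0 := tagged_nonneg hW hacc hPXoff hPXin hPXdiag hPXout hPXstay hK1 hNC
  have hP1 := tagged_rowsum (P := PX) hPXdiag hPXstay
  have hut0 : ∀ t, 0 ≤ ut t := geomResolvent_nonneg hP0 hP1 hσ0 hσ1 (ν := fun t => PX (some z) t) (fun t => hP0 _ _) hut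
  have hsl_none : 0 ≤ sl none := by
    rw [hsl]; linarith only [tagged_supersolution_none hW hp0 hp hθ hacc hPXout hPXstay hK1 hNC hM hrn hrs hΛn hΛs]
  have hsl_some : ∀ v, NC v ≠ 0 → 0 ≤ sl (some v) := fun v hv => by
    rw [hsl]; linarith only [tagged_supersolution_some hW hp0 hp hθ hacc hPXoff hPXin hPXdiag hK1 hNC hM hrn hrs hΛn hΛs hv]
  have habs : ∀ w, NC w = 0 → ut (some w) = 0 := fun w hw =>
    tagged_tail_absent hW hacc hPXoff hPXin hPXdiag hPXout hPXstay hK1 hNC hσ0 hσ1 hz hut hw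
  have hΛz : Λ (some z) = 0 := hΛs z
  have hEΛ : ∑ t, ut t * Λ t = -(1 - θ a) * ut none := by rw [tagged_sum_option, hΛn]; simp [hΛs]; ring
  have hEr : ∑ t, ut t * r t = (K + M) * ut none - (∑ v, ut (some v) * (1 - θ v) + ut none * (1 - θ a)) := by
    rw [tagged_sum_option, hrn]; simp only [hrs]
    have e : ∑ v, ut (some v) * -(1 - θ v) = -∑ v, ut (some v) * (1 - θ v) := by rw [← sum_neg_distrib]; exact sum_congr rfl fun v _ => by ring
    rw [e]; ring
  have hs1eq : (K + M) * ut none - (∑ v, ut (some v) * (1 - θ v) + ut none * (1 - θ a))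
      = (1 - σ) * sl (some z) + σ * ∑ t, ut t * sl t + (1 - σ) * ((1 - θ a) * ut none) := by
    rw [← hEr, heq, hΛz, hEΛ]; ring
  have htail0 : 0 ≤ (1 - σ) * ((1 - θ a) * ut none) :=
    mul_nonneg (by linarith only [hσ1]) (mul_nonneg (by linarith only [(hθm a).2]) (hut0 none))
  -- `E_ũ[slack] ≥ ũ(z)slack(z) + ũ(★)slack(★)`
  have hE : ut (some z) * sl (some z) + ut none * sl none ≤ ∑ t, ut t * sl t := by
    rw [tagged_sum_option, ← add_sum_erase univ (fun v => ut (some v) * sl (some v)) (mem_univ z)]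
    have hrest : 0 ≤ ∑ v ∈ univ.erase z, ut (some v) * sl (some v) := by
      refine sum_nonneg fun v _ => ?_
      by_cases hv : NC v = 0
      · rw [habs v hv, zero_mul]
      · exact mul_nonneg (hut0 _) (hsl_some v hv)
    linarith
  -- the kernel data of the residual pair
  set α := acc z a with hαdef
  have hαeq : α = W z / W a := by rw [hαdef, hacc]; exact min_eq_right ((div_le_one (hW a)).mpr hza.le)
  have hα0 : 0 ≤ α := starHub_acc_nonneg hW hacc z a
  have hα1 : α ≤ 1 := by rw [hαdef, hacc]; exact min_le_left _ _
  have hoff := costSide_residual_offsum hW hacc hK1 hNC hPXoff hz1 hbelow (PX := PX)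
  have hPzn : PX (some z) none = α / K := by rw [hPXin, if_neg hz]
  have hPzz : PX (some z) (some z) = (1 - α) / K := by
    rw [hPXdiag, hoff, hPzn]; field_simp; ring
  have hPnz : PX none (some z) = 1 / K := by
    rw [hPXout, hz1, hacc, min_eq_left ((one_le_div (hW z)).mpr hza.le)]; simp
  -- the two resolvent inequalities on `{z, ★}`
  have huz : (1 - σ) * ((1 - α) / K) + σ * (ut (some z) * ((1 - α) / K) + ut none * (1 / K)) ≤ ut (some z) := by
    have h := hut (some z)
    rw [hPzz, tagged_sum_option, hPnz, ← add_sum_erase univ (fun v => ut (some v) * PX (some v) (some z)) (mem_univ z), hPzz] at h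
    have hrest : 0 ≤ ∑ v ∈ univ.erase z, ut (some v) * PX (some v) (some z) := sum_nonneg fun v _ => mul_nonneg (hut0 _) (hP0 _ _)
    have hσrest := mul_nonneg hσ0 hrest
    linarith [h, hσrest]
  have hun : (1 - σ) * (α / K) + σ * (ut (some z) * (α / K)) ≤ ut none := by
    have h := hut none
    rw [hPzn, tagged_sum_option, ← add_sum_erase univ (fun v => ut (some v) * PX (some v) none) (mem_univ z), hPzn] at h
    have hrest : 0 ≤ ∑ v ∈ univ.erase z, ut (some v) * PX (some v) none := sum_nonneg fun v _ => mul_nonneg (hut0 _) (hP0 _ _)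
    have hnn : 0 ≤ ut none * PX none none := mul_nonneg (hut0 _) (hP0 _ _)
    have hσrest := mul_nonneg hσ0 (add_nonneg hnn hrest)
    linarith [h, hσrest]
  -- `A = (1−σ) + σũ(z) ≥ (1−σ)/det`, `det = (1 − σ/K)(1 + σα/K)`
  set A := (1 - σ) + σ * ut (some z) with hAdef
  have hA0 : 0 ≤ A := by rw [hAdef]; linarith [mul_nonneg hσ0 (hut0 (some z))]
  have hσK : σ / K ≤ 1 / 2 := by rw [div_le_iff₀ hK0]; linarith
  have hdet1 : 0 < 1 - σ / K := by linarith
  have hσαK : 0 ≤ σ * α / K := by positivity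
  have hdet2 : 0 < 1 + σ * α / K := by linarith
  have hdet : 0 < (1 - σ / K) * (1 + σ * α / K) := mul_pos hdet1 hdet2
  have hv : α / K * A ≤ ut none := by
    calc α / K * A = (1 - σ) * (α / K) + σ * (ut (some z) * (α / K)) := by rw [hAdef]; ring
      _ ≤ ut none := hun
  have hAkey : (1 - σ) ≤ A * ((1 - σ / K) * (1 + σ * α / K)) := by
    -- from `huz` and `hv`: `ũ(z) ≥ ((1−α)/K)A + (σ/K)ũ(★) ≥ ((1−α)/K)A + (σα/K²)A`
    have h1 : (1 - α) / K * A + σ / K * ut none ≤ ut (some z) := by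
      calc (1 - α) / K * A + σ / K * ut none = (1 - σ) * ((1 - α) / K) + σ * (ut (some z) * ((1 - α) / K) + ut none * (1 / K)) := by
            rw [hAdef]; ring
        _ ≤ ut (some z) := huz
    have h2 : σ / K * (α / K * A) ≤ σ / K * ut none := mul_le_mul_of_nonneg_left hv (by positivity)
    have h3 : (1 - α) / K * A + σ / K * (α / K * A) ≤ ut (some z) := by linarith
    have h4 : σ * ((1 - α) / K * A + σ / K * (α / K * A)) ≤ σ * ut (some z) := mul_le_mul_of_nonneg_left h3 hσ0
    calc (1 - σ) = A - σ * ut (some z) := by rw [hAdef]; ring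
      _ ≤ A - σ * ((1 - α) / K * A + σ / K * (α / K * A)) := by linarith
      _ = A * ((1 - σ / K) * (1 + σ * α / K)) := by ring
  -- the incomes at `z` and at ★
  have hhold : PX (some z) (some z) ≤ (NC z : ℝ) / K := by
    rw [hPzz, hz1]; push_cast; exact div_le_div_of_nonneg_right (by linarith) hK0.le
  have hslz := costSide_slack_ge hW hp0 hp hθ hacc hPXoff hPXin hK1 hM hrn hrs hΛn hΛs hsl hz hhold
  have hle : ∀ w, NC w ≠ 0 → W w ≤ W z := fun w hw => by
    by_cases hwz : w = z
    · rw [hwz]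
    · exact (hbelow w hwz hw).le
  have hsls := costSide_residual_slack_none hW hp0 hp hθ hacc hPXout hPXstay hK hNC hM hrn hrs hΛn hΛs hsl hle (z := z)
  have hθza := costSide_residual_theta hW hp0 hp hθ hza.le (θ := θ)
  rw [← hαeq] at hθza
  set slz := α * ((K : ℝ) - 2 + 3 * θ a) / K with hslzdef
  set sls := (1 - α) * (1 - θ a) / (1 + α) with hslsdef
  have hslz0 : 0 ≤ slz := by
    rw [hslzdef]
    have h1 : 0 ≤ (K : ℝ) - 2 + 3 * θ a := by linarith [(hθm a).1]
    exact div_nonneg (mul_nonneg hα0 h1) hK0.le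
  have hsls0 : 0 ≤ sls := by rw [hslsdef]; have := (hθm a).2; exact div_nonneg (mul_nonneg (by linarith) (by linarith)) (by linarith)
  have hslz' : slz ≤ sl (some z) := hslz
  have hsls' : sls ≤ sl none := hθza.trans hsls
  -- `s1 ≥ A·slz + σ·ũ(★)·sls ≥ A(slz + σ(α/K)sls) ≥ (1−σ)(slz + σ(α/K)sls)/det`
  have hs1 : (1 - σ) * (slz + σ * (α / K) * sls) / ((1 - σ / K) * (1 + σ * α / K))
      ≤ (K + M) * ut none - (∑ v, ut (some v) * (1 - θ v) + ut none * (1 - θ a)) := by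
    rw [hs1eq, div_le_iff₀ hdet]
    have h1 : A * slz ≤ (1 - σ) * sl (some z) + σ * (ut (some z) * sl (some z)) := by
      have e : (1 - σ) * sl (some z) + σ * (ut (some z) * sl (some z)) = A * sl (some z) := by rw [hAdef]; ring
      rw [e]; exact mul_le_mul_of_nonneg_left hslz' hA0
    have h2 : σ * (α / K * A) * sls ≤ σ * (ut none * sl none) := by
      rw [mul_assoc]
      exact mul_le_mul_of_nonneg_left (mul_le_mul hv hsls' hsls0 (hut0 none)) hσ0
    have h3 : A * (slz + σ * (α / K) * sls) ≤ (1 - σ) * sl (some z) + σ * ∑ t, ut t * sl t + (1 - σ) * ((1 - θ a) * ut none) := by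
      have := mul_le_mul_of_nonneg_left hE hσ0
      linarith [h1, h2, this, htail0]
    have h4 : 0 ≤ slz + σ * (α / K) * sls := by positivity
    calc (1 - σ) * (slz + σ * (α / K) * sls) ≤ A * ((1 - σ / K) * (1 + σ * α / K)) * (slz + σ * (α / K) * sls) :=
          mul_le_mul_of_nonneg_right hAkey h4
      _ = A * (slz + σ * (α / K) * sls) * ((1 - σ / K) * (1 + σ * α / K)) := by ring
      _ ≤ _ := mul_le_mul_of_nonneg_right h3 hdet.le
  rw [hslzdef, hslsdef, hαeq] at hs1
  exact hs1

end ResidualIncome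

end Summit.Ventures.LatticeQCDFlow.Scaling
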